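import Summits.AtomisticToContinuum.HydrodynamicLimit.Theses.JParityClosure
import Summits.AtomisticToContinuum.HydrodynamicLimit.Theorems.JParityClosureRateFloorRung0

/-!
# Door v4 for crux `RateFloor` (stmt-AtomisticToContinuum-13080, route JParityClosure): the REFERENCE-ANCHORED
# restatement `RateFloorRefAnchored` and its corrected two-stub skeleton (line lead c11, 2026-08-17)

NOT a skeleton for the FILED decl `Theses.JParityClosure.RateFloor` (unguarded `∀ τ`; no honest skeleton concludes it —
STRATEGY-CENSUS §3, VERDICT-c10 §3, VERDICT-c11 §2) and deliberately NOT registered with `ledger skeleton check`.  It is the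
kernel-checked replacement text + composition that this seat's `verdict: misstated` names, correcting three typing defects
of the v3 door (`StrategistAnchoredSkeleton.lean` + c10's `RateFloorRestated.lean` R2), see `VERDICT-c11.md` §3:

* F1 — v3's stubs `AnchoredPlateau` (S2) / `AnchoredRealisedFloor` (S3) compare the empirical functionals with
  `Pr = ∫∫ χ ρ² Θ^Ξ[M_{u,θ}]` built from the density `ρ` of an ARBITRARY classical Euler solution, in a frame (R2) that
  carries NO law of large numbers linking `ρ` to the particle system and no mass normalisation
  (`IsHardSphereEulerSolution` has none: `IsHardSphereEulerSolutionDim.const σ T u₀ hρ hθ` gives the constant states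
  `(c, 0, θ₀)` for EVERY `c > 0`).  At rung 0 (constant profiles, `a s ≡ a₀`, Gibbs invariance ⇒ anchor with `klDiv = 0`)
  S2 is therefore FALSE for `c ≪ 1` (its event becomes `{η' < ∫∫χB_r}`, which has probability `→ 1` by c2's two-sided
  `integral_abs_pairFunctional_sub_le`) and S3 is FALSE for `c ≫ 1` (its floor `g₄σ³Pr − η → ∞` while
  `S_R ≤ K_N[χΞ]` has bounded Gibbs mean, `lintegral_numCollisions_le`).  The composition was fine; the cut was not.
* F2 — v3/R2 quantify the activity family only slice-wise (`∀ s, Continuous (a s)`): the reference mean below (and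
  every window-uniform static constant of S2/S3) needs JOINT continuity on `[0,τ] × 𝕋³`; and R2's
  `IsHardSphereEulerSolution` quantifier is idle (only continuity/positivity of `u, θ` on `[0,τ]` is ever used) —
  dropped here, which makes the text MORE general and the consumer's instantiation (at the Euler-driven reference
  `a = ρ e^{g_σ(ρ)}`, `JaynesSqueezeClosure.klCore_at_of_meanFields`) a one-liner.  A dilute-reference band
  `a σ³ ≤ η₀ ∫a` with `∃ η₀` universal is added next to `∃ g₀` (as in `ParityInBand`), since every static input is a
  low-density statement.
* F3 — THE CUT: both stubs are stated relative to the SAME real number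
  `M_{r,N} = ∫₀^τ E_{LG(a_s,u_s,θ_s)}[∫ χ(s,·) B^Ξ_r] ds`, the reference-law mean of the crux's own B-functional.  `ρ`
  never enters, nothing about `M` needs evaluating in the composition, and the rung-0 instances of both stubs are (up to
  bookkeeping) LANDED: S2″ ⇐ `RateFloorPairFunctionalUpper.pairFunctional_upper_inProb_rung0` (p118154 family) with
  `integral_abs_pairFunctional_sub_le` for `M ≥ ½Θ̄∫∫χ`; S3″ ⇐ `RateFloorStaticFloor.stub_staticOpacityFloorRung0`
  (p123314) + `RateFloorNoBursts.stub_noBurstsRung0` (p122968) + realised ≥ would-be − bursts (p97016/p98201).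

Contents: `RateFloorRefAnchored` (R2″, the proposed crux-4 text), `RefPlateau` (S2″), `RefRealisedFloor` (S3″, hardest),
the two stubs (sorried — this is a skeleton), `rateFloorRefAnchored_of_rateFloor` (R2″ is a WEAKENING of the filed crux:
rung 0 p123815 and the 46 `--supports` files keep their value), `rateFloorRefAnchored_of : RefPlateau → RefRealisedFloor →
RateFloorRefAnchored` (PROVED: sure `K ≥ S_R` on good orbits = `RateFloorRung0.lineSR_le_collisionFunctional`, `η ↦ (η/g₄, η/2)`,
`δ ↦ (δ/2, δ/2)`, `r₀ := min`, `N₀ := max`, `Δ` from the floor, union with the Liouville-null bad set, `g₀ := g₄/2`, `η₀ := min`),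
and the glue `ParityBandClosureRefAnchored` / `parityBandClosure_of_refAnchored` / `closes_refAnchored` (deciding theorem
keeps its one-line shape).  `lean check`: rc 0, sorries = the two `stub_*` only.
-/

noncomputable section

open scoped BigOperators Topology ENNReal NNReal InnerProductSpace RealInnerProductSpace Classical
open MeasureTheory Set Filter Function
open Literature.Analysis.FluidPDE Literature.MathematicalPhysics.KineticTheory
open Summit.AtomisticToContinuum.HydrodynamicLimit.Theorems
open Summit.AtomisticToContinuum.HydrodynamicLimit.Theorems.RateFloorLine
open Summit.AtomisticToContinuum.HydrodynamicLimit.Theorems.RateFloorRung0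

namespace Summit.AtomisticToContinuum.HydrodynamicLimit.Cruxes.RateFloor.AnchoredWindowTransportC11

/-- **RateFloorRefAnchored** (R2″, proposed replacement text for crux 4).  `∃ g₀, η₀ > 0` universal; for
continuous warm initial profiles, `σ < σ₀(profiles)`, every flow family `Φ`, every horizon `τ > 0` and every
REFERENCE family `(a, u, θ)` jointly continuous on `[0,τ] × 𝕋³` with `a, θ > 0` and dilute (`a σ³ ≤ η₀ ∫ a`): IF the
law at every `s ∈ [0,τ]` is within specific relative entropy `o(1)` of the local Gibbs law `LG(a s, u s, θ s)`
(the entropic anchor), THEN the filed floor holds — everything from `∀ χ` on is the filed text verbatim. [folklore] -/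
def RateFloorRefAnchored : Prop :=
  ∃ g₀ : ℝ, 0 < g₀ ∧ ∃ η₀ : ℝ, 0 < η₀ ∧ ∀ (a₀ θ₀ : Literature.MathematicalPhysics.KineticTheory.T3 → ℝ) (u₀ : Literature.MathematicalPhysics.KineticTheory.T3 → Literature.MathematicalPhysics.KineticTheory.V3), Continuous a₀ → Continuous θ₀ → Continuous u₀ → (∀ x, 0 < a₀ x) → (∀ x, 0 < θ₀ x) → ∃ σ₀ : ℝ, 0 < σ₀ ∧ ∀ σ : ℝ, 0 < σ → σ < σ₀ → ∀ Φ : (N : ℕ) → Literature.Analysis.FluidPDE.HardSphereFlow (Literature.Analysis.FluidPDE.Torus.geometry (Fin 3)) (Literature.MathematicalPhysics.KineticTheory.hsDiameter σ N) (N + 1), ∀ τ : ℝ, 0 < τ → ∀ (a θ : ℝ → Literature.MathematicalPhysics.KineticTheory.T3 → ℝ) (u : ℝ → Literature.MathematicalPhysics.KineticTheory.T3 → Literature.MathematicalPhysics.KineticTheory.V3), ContinuousOn (Function.uncurry a) (Set.Icc (0 : ℝ) τ ×ˢ Set.univ) → ContinuousOn (Function.uncurry θ) (Set.Icc (0 :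 ℝ) τ ×ˢ Set.univ) → ContinuousOn (Function.uncurry u) (Set.Icc (0 : ℝ) τ ×ˢ Set.univ) → (∀ s ∈ Set.Icc (0 : ℝ) τ, ∀ x, 0 < a s x) → (∀ s ∈ Set.Icc (0 : ℝ) τ, ∀ x, 0 < θ s x) → (∀ s ∈ Set.Icc (0 : ℝ) τ, ∀ x, a s x * σ ^ 3 ≤ η₀ * ∫ y, a s y) → (∀ κ : ℝ, 0 < κ → ∃ N₁ : ℕ, ∀ N : ℕ, N₁ ≤ N → ∀ s ∈ Set.Icc (0 : ℝ) τ, InformationTheory.klDiv ((Φ N).lawAt (Literature.MathematicalPhysics.KineticTheory.localGibbsLaw σ a₀ u₀ θ₀ N (Φ N)) s) (Literature.MathematicalPhysics.KineticTheory.localGibbsLaw σ (a s) (u s) (θ s) N (Φ N)) ≤ ENNReal.ofReal (κ * ((N : ℝ) + 1))) → ∀ χ : ℝ × UnitAddTorus (Fin 3) → ℝ, Continuous χ → (∀ p, 0 ≤ χ p) → ∀ Ξ : EuclideanSpace ℝ (Fin 3) × EuclideanSpace ℝ (Fin 3) × EuclideanSpace ℝ (Fin 3) → ℝ, Continuous Ξ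 → (∀ q, 0 ≤ Ξ q) → (∃ C : ℝ, ∀ q, Ξ q ≤ C) → ∀ η δ : ℝ, 0 < η → 0 < δ → ∃ r₀ : ℝ, 0 < r₀ ∧ ∀ r : ℝ, 0 < r → r < r₀ → ∃ N₀ : ℕ, ∀ N : ℕ, N₀ ≤ N → let ε := Literature.MathematicalPhysics.KineticTheory.hsDiameter σ N; let G := Literature.Analysis.FluidPDE.Torus.geometry (Fin 3); let γ := fun z (s : ℝ) => (Φ N).flow s z; let bx : UnitAddTorus (Fin 3) → UnitAddTorus (Fin 3) → ℝ := fun x y => 3 / (Real.pi * r ^ 3) * max (1 - Literature.Analysis.FluidPDE.Torus.euclidDist x y / r) 0; let Θ := fun (Ξ : EuclideanSpace ℝ (Fin 3) × EuclideanSpace ℝ (Fin 3) × EuclideanSpace ℝ (Fin 3) → ℝ) (v w : EuclideanSpace ℝ (Fin 3)) => ∫ ω : Metric.sphere (0 : EuclideanSpace ℝ (Fin 3)) 1, Ξ ((ω : EuclideanSpace ℝ (Fin 3)), v, w) * Literature.MathematicalPhysics.KineticTheory.hardSphereKernel (w, v) ω ∂Literature.MathematicalPhysics.KineticTheory.sphereMeasure;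 let B := fun Ξ z s (x₀ : UnitAddTorus (Fin 3)) => ∫ p, bx p.1.1 x₀ * bx p.2.1 x₀ * Θ Ξ p.1.2 p.2.2 ∂((Literature.Analysis.FluidPDE.empiricalMeasure (γ z s)).prod (Literature.Analysis.FluidPDE.empiricalMeasure (γ z s))); let pv := fun z s (i j : Fin (N + 1)) => Literature.Analysis.FluidPDE.reflectVel (G.sepVec (γ z s i).1 (γ z s j).1) ((γ z s i).2, (γ z s j).2); let Kc := fun (Fn : Literature.Analysis.FluidPDE.Config (N + 1) (Fin 3) Literature.MathematicalPhysics.KineticTheory.T3 → ℝ → Fin (N + 1) → Fin (N + 1) → ℝ) z => ε / (N + 1 : ℝ) * ∑ᶠ (s : ℝ) (_ : s ∈ Literature.Analysis.FluidPDE.collisionTimes G ε (γ z) ∩ Set.Icc 0 τ), ∑ i : Fin (N + 1), ∑ j : Fin (N + 1), (if i ≠ j ∧ ‖G.sepVec (γ z s i).1 (γ z s j).1‖ = ε then Fn z s i j else 0); Literature.MathematicalPhysics.KineticTheory.localGibbsLaw σ a₀ u₀ θ₀ N (Φ N) {z | Kc (fun z s i j => χ (s, (γ z s i).1) * Ξ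 (ε⁻¹ • G.sepVec (γ z s i).1 (γ z s j).1, (pv z s i j).1, (pv z s i j).2)) z < g₀ * σ ^ 3 * (∫ s in Set.Icc (0 : ℝ) τ, ∫ x : UnitAddTorus (Fin 3), χ (s, x) * B Ξ z s x) - η} ≤ ENNReal.ofReal δ

/-- **RefPlateau** (stub S2″, the r-step as one-time statics).  Same frame; conclusion: for `r < r₀`, eventually in
`N`, `P(2·M_{r,N} + η < ∫₀^τ∫ χ B^Ξ_r(z_s)) ≤ δ`, where `M_{r,N} = ∫₀^τ E_{LG(a s,u s,θ s)}[∫ χ(s,·) B^Ξ_r] ds` is the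
reference-law mean of the crux's own B-functional (`B0` = the static B-functional of a configuration). [folklore] -/
def RefPlateau : Prop :=
  ∃ η₀ : ℝ, 0 < η₀ ∧ ∀ (a₀ θ₀ : Literature.MathematicalPhysics.KineticTheory.T3 → ℝ) (u₀ : Literature.MathematicalPhysics.KineticTheory.T3 → Literature.MathematicalPhysics.KineticTheory.V3), Continuous a₀ → Continuous θ₀ → Continuous u₀ → (∀ x, 0 < a₀ x) → (∀ x, 0 < θ₀ x) → ∃ σ₀ : ℝ, 0 < σ₀ ∧ ∀ σ : ℝ, 0 < σ → σ < σ₀ → ∀ Φ : (N : ℕ) → Literature.Analysis.FluidPDE.HardSphereFlow (Literature.Analysis.FluidPDE.Torus.geometry (Fin 3)) (Literature.MathematicalPhysics.KineticTheory.hsDiameter σ N) (N + 1), ∀ τ : ℝ, 0 < τ → ∀ (a θ : ℝ → Literature.MathematicalPhysics.KineticTheory.T3 → ℝ) (u : ℝ → Literature.MathematicalPhysics.KineticTheory.T3 → Literature.MathematicalPhysics.KineticTheory.V3), ContinuousOn (Function.uncurry a) (Set.Icc (0 : ℝ) τ ×ˢ Set.univ) → ContinuousOn (Function.uncurry θ)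 (Set.Icc (0 : ℝ) τ ×ˢ Set.univ) → ContinuousOn (Function.uncurry u) (Set.Icc (0 : ℝ) τ ×ˢ Set.univ) → (∀ s ∈ Set.Icc (0 : ℝ) τ, ∀ x, 0 < a s x) → (∀ s ∈ Set.Icc (0 : ℝ) τ, ∀ x, 0 < θ s x) → (∀ s ∈ Set.Icc (0 : ℝ) τ, ∀ x, a s x * σ ^ 3 ≤ η₀ * ∫ y, a s y) → (∀ κ : ℝ, 0 < κ → ∃ N₁ : ℕ, ∀ N : ℕ, N₁ ≤ N → ∀ s ∈ Set.Icc (0 : ℝ) τ, InformationTheory.klDiv ((Φ N).lawAt (Literature.MathematicalPhysics.KineticTheory.localGibbsLaw σ a₀ u₀ θ₀ N (Φ N)) s) (Literature.MathematicalPhysics.KineticTheory.localGibbsLaw σ (a s) (u s) (θ s) N (Φ N)) ≤ ENNReal.ofReal (κ * ((N : ℝ) + 1))) → ∀ χ : ℝ × UnitAddTorus (Fin 3) → ℝ, Continuous χ → (∀ p, 0 ≤ χ p) → ∀ Ξ : EuclideanSpace ℝ (Fin 3) × EuclideanSpace ℝ (Fin 3) × EuclideanSpace ℝ (Fin 3)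 → ℝ, Continuous Ξ → (∀ q, 0 ≤ Ξ q) → (∃ C : ℝ, ∀ q, Ξ q ≤ C) → ∀ η δ : ℝ, 0 < η → 0 < δ → ∃ r₀ : ℝ, 0 < r₀ ∧ ∀ r : ℝ, 0 < r → r < r₀ → ∃ N₀ : ℕ, ∀ N : ℕ, N₀ ≤ N → let γ := fun z (s : ℝ) => (Φ N).flow s z; let bx : UnitAddTorus (Fin 3) → UnitAddTorus (Fin 3) → ℝ := fun x y => 3 / (Real.pi * r ^ 3) * max (1 - Literature.Analysis.FluidPDE.Torus.euclidDist x y / r) 0; let Θ := fun (Ξ : EuclideanSpace ℝ (Fin 3) × EuclideanSpace ℝ (Fin 3) × EuclideanSpace ℝ (Fin 3) → ℝ) (v w : EuclideanSpace ℝ (Fin 3)) => ∫ ω : Metric.sphere (0 : EuclideanSpace ℝ (Fin 3)) 1, Ξ ((ω : EuclideanSpace ℝ (Fin 3)), v, w) * Literature.MathematicalPhysics.KineticTheory.hardSphereKernel (w, v) ω ∂Literature.MathematicalPhysics.KineticTheory.sphereMeasure; let B := fun Ξ z s (x₀ : UnitAddTorus (Fin 3)) => ∫ p, bx p.1.1 x₀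 * bx p.2.1 x₀ * Θ Ξ p.1.2 p.2.2 ∂((Literature.Analysis.FluidPDE.empiricalMeasure (γ z s)).prod (Literature.Analysis.FluidPDE.empiricalMeasure (γ z s))); let B0 := fun Ξ (z' : Literature.Analysis.FluidPDE.Config (N + 1) (Fin 3) Literature.MathematicalPhysics.KineticTheory.T3) (x₀ : UnitAddTorus (Fin 3)) => ∫ p, bx p.1.1 x₀ * bx p.2.1 x₀ * Θ Ξ p.1.2 p.2.2 ∂((Literature.Analysis.FluidPDE.empiricalMeasure z').prod (Literature.Analysis.FluidPDE.empiricalMeasure z')); let M : ℝ := ∫ s in Set.Icc (0 : ℝ) τ, ∫ z', (∫ x : UnitAddTorus (Fin 3), χ (s, x) * B0 Ξ z' x) ∂(Literature.MathematicalPhysics.KineticTheory.localGibbsLaw σ (a s) (u s) (θ s) N (Φ N)); Literature.MathematicalPhysics.KineticTheory.localGibbsLaw σ a₀ u₀ θ₀ N (Φ N) {z | 2 * M + η < ∫ s in Set.Icc (0 : ℝ) τ, ∫ x : UnitAddTorus (Fin 3), χ (s, x) * B Ξ z s x} ≤ ENNReal.ofReal δ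

/-- **RefRealisedFloor** (stub S3″, the line's heart).  Same frame; `∃ g₄ > 0` universal; conclusion: for `r < r₀`,
eventually in `N`, for SOME window length `Δ > 0` (the stub prover's choice: `A (N+1)^(-1/3)` with isolated pairs, or
`(N+1)^(-1/2)` with the rung-0 burst charge — the composition only uses the sure `K ≥ S_R(Δ)` for every `Δ > 0`),
`P(S_R < g₄ σ³ M_{r,N} − η) ≤ δ`, `S_R = lineSR ε Δ τ γ (χ·Ξ)` the REALISED would-be functional (landed definitions file
`JParityClosureRateFloorLineDefs`). [folklore] -/
def RefRealisedFloor : Prop :=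
  ∃ g₄ : ℝ, 0 < g₄ ∧ ∃ η₀ : ℝ, 0 < η₀ ∧ ∀ (a₀ θ₀ : Literature.MathematicalPhysics.KineticTheory.T3 → ℝ) (u₀ : Literature.MathematicalPhysics.KineticTheory.T3 → Literature.MathematicalPhysics.KineticTheory.V3), Continuous a₀ → Continuous θ₀ → Continuous u₀ → (∀ x, 0 < a₀ x) → (∀ x, 0 < θ₀ x) → ∃ σ₀ : ℝ, 0 < σ₀ ∧ ∀ σ : ℝ, 0 < σ → σ < σ₀ → ∀ Φ : (N : ℕ) → Literature.Analysis.FluidPDE.HardSphereFlow (Literature.Analysis.FluidPDE.Torus.geometry (Fin 3)) (Literature.MathematicalPhysics.KineticTheory.hsDiameter σ N) (N + 1), ∀ τ : ℝ, 0 < τ → ∀ (a θ : ℝ → Literature.MathematicalPhysics.KineticTheory.T3 → ℝ) (u : ℝ → Literature.MathematicalPhysics.KineticTheory.T3 → Literature.MathematicalPhysics.KineticTheory.V3), ContinuousOn (Function.uncurry a) (Set.Icc (0 : ℝ) τ ×ˢ Set.univ) → ContinuousOn (Function.uncurry θ) (Set.Icc (0 : ℝ) τ ×ˢ Set.univ)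 → ContinuousOn (Function.uncurry u) (Set.Icc (0 : ℝ) τ ×ˢ Set.univ) → (∀ s ∈ Set.Icc (0 : ℝ) τ, ∀ x, 0 < a s x) → (∀ s ∈ Set.Icc (0 : ℝ) τ, ∀ x, 0 < θ s x) → (∀ s ∈ Set.Icc (0 : ℝ) τ, ∀ x, a s x * σ ^ 3 ≤ η₀ * ∫ y, a s y) → (∀ κ : ℝ, 0 < κ → ∃ N₁ : ℕ, ∀ N : ℕ, N₁ ≤ N → ∀ s ∈ Set.Icc (0 : ℝ) τ, InformationTheory.klDiv ((Φ N).lawAt (Literature.MathematicalPhysics.KineticTheory.localGibbsLaw σ a₀ u₀ θ₀ N (Φ N)) s) (Literature.MathematicalPhysics.KineticTheory.localGibbsLaw σ (a s) (u s) (θ s) N (Φ N)) ≤ ENNReal.ofReal (κ * ((N : ℝ) + 1))) → ∀ χ : ℝ × UnitAddTorus (Fin 3) → ℝ, Continuous χ → (∀ p, 0 ≤ χ p) → ∀ Ξ : EuclideanSpace ℝ (Fin 3) × EuclideanSpace ℝ (Fin 3) × EuclideanSpace ℝ (Fin 3) → ℝ, Continuous Ξ → (∀ q, 0 ≤ Ξ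 q) → (∃ C : ℝ, ∀ q, Ξ q ≤ C) → ∀ η δ : ℝ, 0 < η → 0 < δ → ∃ r₀ : ℝ, 0 < r₀ ∧ ∀ r : ℝ, 0 < r → r < r₀ → ∃ N₀ : ℕ, ∀ N : ℕ, N₀ ≤ N → ∃ Δ : ℝ, 0 < Δ ∧ let ε := Literature.MathematicalPhysics.KineticTheory.hsDiameter σ N; let G := Literature.Analysis.FluidPDE.Torus.geometry (Fin 3); let γ := fun z (s : ℝ) => (Φ N).flow s z; let bx : UnitAddTorus (Fin 3) → UnitAddTorus (Fin 3) → ℝ := fun x y => 3 / (Real.pi * r ^ 3) * max (1 - Literature.Analysis.FluidPDE.Torus.euclidDist x y / r) 0; let Θ := fun (Ξ : EuclideanSpace ℝ (Fin 3) × EuclideanSpace ℝ (Fin 3) × EuclideanSpace ℝ (Fin 3) → ℝ) (v w : EuclideanSpace ℝ (Fin 3)) => ∫ ω : Metric.sphere (0 : EuclideanSpace ℝ (Fin 3)) 1, Ξ ((ω : EuclideanSpace ℝ (Fin 3)), v, w) * Literature.MathematicalPhysics.KineticTheory.hardSphereKernel (w, v) ω ∂Literature.MathematicalPhysics.KineticTheory.sphereMeasure;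 let B0 := fun Ξ (z' : Literature.Analysis.FluidPDE.Config (N + 1) (Fin 3) Literature.MathematicalPhysics.KineticTheory.T3) (x₀ : UnitAddTorus (Fin 3)) => ∫ p, bx p.1.1 x₀ * bx p.2.1 x₀ * Θ Ξ p.1.2 p.2.2 ∂((Literature.Analysis.FluidPDE.empiricalMeasure z').prod (Literature.Analysis.FluidPDE.empiricalMeasure z')); let M : ℝ := ∫ s in Set.Icc (0 : ℝ) τ, ∫ z', (∫ x : UnitAddTorus (Fin 3), χ (s, x) * B0 Ξ z' x) ∂(Literature.MathematicalPhysics.KineticTheory.localGibbsLaw σ (a s) (u s) (θ s) N (Φ N)); let SR := fun (z : Literature.Analysis.FluidPDE.Config (N + 1) (Fin 3) Literature.MathematicalPhysics.KineticTheory.T3) => Summit.AtomisticToContinuum.HydrodynamicLimit.Theorems.RateFloorLine.lineSR ε Δ τ (γ z) (fun u' x y v w => χ (u', x) * Ξ (ε⁻¹ • G.sepVec x y, v, w)); Literature.MathematicalPhysics.KineticTheory.localGibbsLaw σ a₀ u₀ θ₀ N (Φ N) {z | SR z < g₄ * σ ^ 3 * M - η} ≤ ENNReal.ofReal δ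

/-! ### The two stubs (sorried: this is a skeleton for the RESTATED decl, not registered) -/

/-- S2″ — reference plateau (upper tail of the U-statistic `∫χB_r` under the dilute jointly-continuous local Gibbs
reference, rate `N`; expectation-form entropy inequality per `s`; Fubini + Markov in `s`). -/
theorem stub_refPlateau : RefPlateau := by
  sorry

/-- S3″ — reference realised floor (isolated would-be 2-clusters collide; static lower tail of the isolated functional
at tilt `c (N+1)^(4/3)` under the dilute reference; per-window entropy inequality; window sum `≲ τσ³κ/(cA) → 0`). -/
theorem stub_refRealisedFloor : RefRealisedFloor := by
  sorry

/-! ### Checked compositions -/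

/-- R2″ is a WEAKENING of the filed crux (all the new hypotheses are simply ignored). [folklore] -/
theorem rateFloorRefAnchored_of_rateFloor (h : Theses.JParityClosure.RateFloor) : RateFloorRefAnchored := by
  obtain ⟨g₀, hg₀, H⟩ := h
  refine ⟨g₀, hg₀, 1, one_pos, fun a₀ θ₀ u₀ ha hθ hu hap hθp => ?_⟩
  obtain ⟨σ₀, hσ₀, H1⟩ := H a₀ θ₀ u₀ ha hθ hu hap hθp
  exact ⟨σ₀, hσ₀, fun σ hσ hσ' Φ τ hτ _ _ _ _ _ _ _ _ _ _ => H1 σ hσ hσ' Φ τ hτ⟩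

/-- The arithmetic of the composition (verbatim the strategist's `anchored_deficit_arith`): from `K < (g₄/2) σ³ I − η`,
`S_R ≤ K`, the plateau `I ≤ 2 M + η/g₄`, the realised floor `S_R ≥ g₄ σ³ M − η/2` and `σ³ ≤ 1`, a contradiction. [folklore] -/
theorem anchored_deficit_arith {K SR I Pr η g₄ s3 : ℝ} (hη : 0 < η) (hg : 0 < g₄) (hs0 : 0 ≤ s3) (hs1 : s3 ≤ 1)
    (hz : K < g₄ / 2 * s3 * I - η) (hKR : SR ≤ K) (hP : ¬ (2 * Pr + η / g₄ < I))
    (hF : ¬ (SR < g₄ * s3 * Pr - η / 2)) : False := by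
  simp only [not_lt] at hP hF
  have h1 : g₄ / 2 * s3 * I ≤ g₄ / 2 * s3 * (2 * Pr + η / g₄) :=
    mul_le_mul_of_nonneg_left hP (by positivity)
  have h2 : g₄ / 2 * s3 * (2 * Pr + η / g₄) = g₄ * s3 * Pr + s3 * η / 2 := by
    field_simp
  have h3 : s3 * η / 2 ≤ η / 2 := by nlinarith
  linarith

/-- A dilute-reference band at level `η₀` is a band at every larger level. [folklore] -/
theorem band_mono {σ η₀ η₁ τ : ℝ} (hle : η₀ ≤ η₁) {a : ℝ → Literature.MathematicalPhysics.KineticTheory.T3 → ℝ}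
    (hapos : ∀ s ∈ Set.Icc (0 : ℝ) τ, ∀ x, 0 < a s x)
    (hband : ∀ s ∈ Set.Icc (0 : ℝ) τ, ∀ x, a s x * σ ^ 3 ≤ η₀ * ∫ y, a s y) :
    ∀ s ∈ Set.Icc (0 : ℝ) τ, ∀ x, a s x * σ ^ 3 ≤ η₁ * ∫ y, a s y := by
  intro s hs x
  have hint : 0 ≤ ∫ y, a s y := integral_nonneg fun y => (hapos s hs y).le
  exact (hband s hs x).trans (mul_le_mul_of_nonneg_right hle hint)

/-- **R2″ from S2″ + S3″** — sure inequality `K ≥ S_R` on good orbits (`RateFloorRung0.lineSR_le_collisionFunctional`),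
the plateau with `η/g₄`, the realised floor with `η/2`, each at confidence `δ/2`, union bound with the Liouville-null
bad set; `g₀ := g₄/2`, `η₀ := min`, `σ₀ := min (min σa σb) ½`, `r₀ := min`, `N₀ := max`, the window length `Δ` from the floor. -/
theorem rateFloorRefAnchored_of (hP : RefPlateau) (hR : RefRealisedFloor) : RateFloorRefAnchored := by
  obtain ⟨η₂, hη₂, hP⟩ := hP
  obtain ⟨g₄, hg₄, η₃, hη₃, hR⟩ := hR
  refine ⟨g₄ / 2, half_pos hg₄, min η₂ η₃, lt_min hη₂ hη₃, fun a₀ θ₀ u₀ ha hθ hu hap hθp => ?_⟩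
  obtain ⟨σa, hσa, hP⟩ := hP a₀ θ₀ u₀ ha hθ hu hap hθp
  obtain ⟨σb, hσb, hR⟩ := hR a₀ θ₀ u₀ ha hθ hu hap hθp
  refine ⟨min (min σa σb) 2⁻¹, lt_min (lt_min hσa hσb) (by norm_num), ?_⟩
  intro σ hσ hσlt Φ τ hτ a θ u hac hθc huc hapos hθpos hband hkl χ hχc hχ0 Ξ hΞc hΞ0 hΞC η δ hη hδ
  have hσa' : σ < σa := hσlt.trans_le ((min_le_left _ _).trans (min_le_left _ _))
  have hσb' : σ < σb := hσlt.trans_le ((min_le_left _ _).trans (min_le_right _ _))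
  have hσ2 : σ < 2⁻¹ := hσlt.trans_le (min_le_right _ _)
  have hband₂ := band_mono (min_le_left η₂ η₃) hapos hband
  have hband₃ := band_mono (min_le_right η₂ η₃) hapos hband
  -- S2″ (plateau) with `η/g₄`, `δ/2`
  obtain ⟨ra, hra, hP⟩ := hP σ hσ hσa' Φ τ hτ a θ u hac hθc huc hapos hθpos hband₂ hkl χ hχc hχ0 Ξ hΞc hΞ0 hΞC (η / g₄)
    (δ / 2) (div_pos hη hg₄) (half_pos hδ)
  -- S3″ (realised floor) with `η/2`, `δ/2`
  obtain ⟨rb, hrb, hR⟩ := hR σ hσ hσb' Φ τ hτ a θ u hac hθc huc hapos hθpos hband₃ hkl χ hχc hχ0 Ξ hΞc hΞ0 hΞC (η / 2)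
    (δ / 2) (half_pos hη) (half_pos hδ)
  refine ⟨min ra rb, lt_min hra hrb, ?_⟩
  intro r hr hrlt
  obtain ⟨Na, hP⟩ := hP r hr (hrlt.trans_le (min_le_left _ _))
  obtain ⟨Nb, hR⟩ := hR r hr (hrlt.trans_le (min_le_right _ _))
  refine ⟨max Na Nb, ?_⟩
  intro N hN
  have h1 := hP N ((le_max_left _ _).trans hN)
  obtain ⟨Δ, hΔ, h2⟩ := hR N ((le_max_right _ _).trans hN)
  intro ε G γ bx Θ B pv Kc
  -- name the reference functional exactly as the stubs do
  set B0 := fun Ξ (z' : Literature.Analysis.FluidPDE.Config (N + 1) (Fin 3) Literature.MathematicalPhysics.KineticTheory.T3)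
      (x₀ : UnitAddTorus (Fin 3)) => ∫ p, bx p.1.1 x₀ * bx p.2.1 x₀ * Θ Ξ p.1.2 p.2.2
        ∂((Literature.Analysis.FluidPDE.empiricalMeasure z').prod (Literature.Analysis.FluidPDE.empiricalMeasure z')) with hB0
  set M : ℝ := ∫ s in Set.Icc (0 : ℝ) τ, ∫ z', (∫ x : UnitAddTorus (Fin 3), χ (s, x) * B0 Ξ z' x)
      ∂(Literature.MathematicalPhysics.KineticTheory.localGibbsLaw σ (a s) (u s) (θ s) N (Φ N)) with hM
  have e1 : Literature.MathematicalPhysics.KineticTheory.localGibbsLaw σ a₀ u₀ θ₀ N (Φ N)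
      {z | 2 * M + η / g₄ < ∫ s in Set.Icc (0 : ℝ) τ, ∫ x : UnitAddTorus (Fin 3), χ (s, x) * B Ξ z s x} ≤
      ENNReal.ofReal (δ / 2) := h1
  have e2 : Literature.MathematicalPhysics.KineticTheory.localGibbsLaw σ a₀ u₀ θ₀ N (Φ N)
      {z | lineSR ε Δ τ (γ z) (fun u' x y v w => χ (u', x) * Ξ (ε⁻¹ • G.sepVec x y, v, w)) <
        g₄ * σ ^ 3 * M - η / 2} ≤
      ENNReal.ofReal (δ / 2) := h2
  -- facts along good trajectories
  have hε : 0 < ε := hsDiameter_pos hσ N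
  have hεlt : ε < 2⁻¹ := (hsDiameter_le hσ.le N).trans_lt hσ2
  have hs3 : σ ^ 3 ≤ 1 := by
    have : σ ≤ 1 := by linarith
    exact pow_le_one₀ hσ.le this
  have hF0 : ∀ (u' : ℝ) (x y : T3) (v w : V3), 0 ≤ χ (u', x) * Ξ (ε⁻¹ • G.sepVec x y, v, w) :=
    fun u' x y v w => mul_nonneg (hχ0 _) (hΞ0 _)
  have hgood : Literature.MathematicalPhysics.KineticTheory.localGibbsLaw σ a₀ u₀ θ₀ N (Φ N) (Φ N).goodᶜ = 0 := by
    rw [Literature.MathematicalPhysics.KineticTheory.localGibbsLaw, particleLaw_eq]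
    exact withDensity_absolutelyContinuous _ _ (Φ N).measure_compl_good
  have hsub : {z | Kc (fun z s i j => χ (s, (γ z s i).1) *
        Ξ (ε⁻¹ • G.sepVec (γ z s i).1 (γ z s j).1, (pv z s i j).1, (pv z s i j).2)) z <
        g₄ / 2 * σ ^ 3 * (∫ s in Set.Icc (0 : ℝ) τ, ∫ x : UnitAddTorus (Fin 3), χ (s, x) * B Ξ z s x) - η} ⊆
      {z | 2 * M + η / g₄ < ∫ s in Set.Icc (0 : ℝ) τ, ∫ x : UnitAddTorus (Fin 3), χ (s, x) * B Ξ z s x} ∪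
      {z | lineSR ε Δ τ (γ z) (fun u' x y v w => χ (u', x) * Ξ (ε⁻¹ • G.sepVec x y, v, w)) <
        g₄ * σ ^ 3 * M - η / 2} ∪
      (Φ N).goodᶜ := by
    intro z hz
    by_contra hcon
    have hca : ¬ (2 * M + η / g₄ < ∫ s in Set.Icc (0 : ℝ) τ, ∫ x : UnitAddTorus (Fin 3), χ (s, x) * B Ξ z s x) :=
      fun h => hcon (Or.inl (Or.inl h))
    have hcb : ¬ (lineSR ε Δ τ (γ z) (fun u' x y v w => χ (u', x) * Ξ (ε⁻¹ • G.sepVec x y, v, w)) <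
        g₄ * σ ^ 3 * M - η / 2) :=
      fun h => hcon (Or.inl (Or.inr h))
    have hzg : z ∈ (Φ N).good := by
      by_contra h
      exact hcon (Or.inr h)
    have htraj : IsHardSphereTrajectory G ε (N + 1) (γ z) := (Φ N).isTrajectory z hzg
    -- sure transfer: K ≥ S_R
    have hKR := lineSR_le_collisionFunctional htraj hε hεlt hΔ hτ.le
      (fun u' x y v w => χ (u', x) * Ξ (ε⁻¹ • G.sepVec x y, v, w)) hF0
    have hz' : Kc (fun z s i j => χ (s, (γ z s i).1) *
        Ξ (ε⁻¹ • G.sepVec (γ z s i).1 (γ z s j).1, (pv z s i j).1, (pv z s i j).2)) z <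
        g₄ / 2 * σ ^ 3 * (∫ s in Set.Icc (0 : ℝ) τ, ∫ x : UnitAddTorus (Fin 3), χ (s, x) * B Ξ z s x) - η := hz
    exact anchored_deficit_arith hη hg₄ (by positivity) hs3 hz' hKR hca hcb
  calc Literature.MathematicalPhysics.KineticTheory.localGibbsLaw σ a₀ u₀ θ₀ N (Φ N) _
      ≤ Literature.MathematicalPhysics.KineticTheory.localGibbsLaw σ a₀ u₀ θ₀ N (Φ N) (_ ∪ _ ∪ (Φ N).goodᶜ) :=
        measure_mono hsub
    _ ≤ Literature.MathematicalPhysics.KineticTheory.localGibbsLaw σ a₀ u₀ θ₀ N (Φ N) _ +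
          Literature.MathematicalPhysics.KineticTheory.localGibbsLaw σ a₀ u₀ θ₀ N (Φ N) _ +
          Literature.MathematicalPhysics.KineticTheory.localGibbsLaw σ a₀ u₀ θ₀ N (Φ N) (Φ N).goodᶜ :=
        (measure_union_le _ _).trans (add_le_add (measure_union_le _ _) le_rfl)
    _ ≤ ENNReal.ofReal (δ / 2) + ENNReal.ofReal (δ / 2) + 0 := add_le_add (add_le_add e1 e2) hgood.le
    _ = ENNReal.ofReal δ := by
        rw [add_zero, ← ENNReal.ofReal_add (half_pos hδ).le (half_pos hδ).le, add_halves]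

/-- The same, fed with the stubs (so that `lean check` reports the sorries exactly at S2″, S3″). -/
theorem rateFloorRefAnchored_skeleton : RateFloorRefAnchored :=
  rateFloorRefAnchored_of stub_refPlateau stub_refRealisedFloor

/-! ### Glue for the planner: the closure crux with its third hypothesis restated alongside -/

/-- The closure crux with the reference-anchored floor as third hypothesis. [folklore] -/
def ParityBandClosureRefAnchored : Prop :=
  Theses.JParityClosure.OddContactSymmetry → Theses.JParityClosure.EvenStressEnskog → RateFloorRefAnchored →
    Theses.JParityClosure.LocalSecondLaw → Theses.JParityClosure.DensityCap → _root_.HydrodynamicLimit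

/-- It implies the filed closure crux (it asks the closure to run on a weaker floor). [folklore] -/
theorem parityBandClosure_of_refAnchored (h : ParityBandClosureRefAnchored) : Theses.JParityClosure.ParityBandClosure :=
  fun h₂ h₃ h₄ h₅ h₆ => h h₂ h₃ (rateFloorRefAnchored_of_rateFloor h₄) h₅ h₆

/-- Shape of the deciding theorem after the restatement: still `h₇ h₂ h₃ h₄ h₅ h₆`. [folklore] -/
theorem closes_refAnchored (h₂ : Theses.JParityClosure.OddContactSymmetry) (h₃ : Theses.JParityClosure.EvenStressEnskog)
    (h₄ : RateFloorRefAnchored) (h₅ : Theses.JParityClosure.LocalSecondLaw) (h₆ : Theses.JParityClosure.DensityCap)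
    (h₇ : ParityBandClosureRefAnchored) : _root_.HydrodynamicLimit :=
  h₇ h₂ h₃ h₄ h₅ h₆

end Summit.AtomisticToContinuum.HydrodynamicLimit.Cruxes.RateFloor.AnchoredWindowTransportC11

end
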